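/-
Copyright (c) 2026. All rights reserved.
Released under Apache 2.0 license as described in the file LICENSE.
Authors: abc-iut cell, prover seat abc-iut-w4-d095 (wave 4), over the statements of abc-iut-L4-t3
(`LogFrobeniusCorollaries.lean`), the reduction of abc-iut-w5-d097 (`LogFrobeniusLogWallPlusOfObstruction.lean`) and the
archimedean model of abc-iut-L4-t2 (`ArchimedeanLogFrobeniusModel.lean`).
-/
import Literature.AnabelianGeometry.AbsoluteAnabelian.LogFrobeniusLogWallPlusOfObstruction
import Literature.AnabelianGeometry.AbsoluteAnabelian.LogFrobeniusObservables
import Literature.AnabelianGeometry.AbsoluteAnabelian.ArchimedeanLogFrobeniusModel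
import Mathlib.CategoryTheory.InducedCategory
import Mathlib.CategoryTheory.Types.Basic
import HarnessLib

/-!
# [AbsTopIII] Corollary 5.5 (iv), first sentence (`⊞`-half): the ARCHIMEDEAN ORIGIN of the cycle obstruction

S. Mochizuki, *Topics in absolute anabelian geometry III: global reconstruction algorithms*, J. Math. Sci. Univ.
Tokyo 22 (2015) 939–1156 [MochizukiAbsTopIII2015]; locators = pages of the author's manuscript
(`paper:url-5493eb38cbb7`): Cor 5.5 (iv) p. 131, its proof pp. 132–133 ("entirely similar to the proofs of assertion
(iv) of Corollaries 3.6, 4.5"), the proof of Cor 4.5 (iv) p. 110 ("by writing out explicitly the meaning of such an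
equality … a contradiction to Lemma 4.4"), Def 5.4 (v) p. 127 (the archimedean graph `Γ⃗^log_v`:
`k~ →(id) k~ ↠ k^× ↪ k`, "the natural inclusion"), Def 4.1 (iv) p. 104 (`λ^×`, `λ^∼`, `ι_×`).

PROOF-ONLY in its first part, a labelled MODEL in its second part; no new `Prop`, no new notion.

* abc-iut-w5-d097 reduced the typed first sentence of Cor 5.5 (iv), `⊞`-half
  (`LogFrobeniusSetting.Cor55Incompatibility`, abc-iut-L4-t3, FACT-LIST F-0141), to ONE component-level input at one
  archimedean place `v₀` (`cor55Incompatibility_of_archObstruction`): for no isomorphism `a : x₀ ⥲ log(x₀)` is the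
  composite `λ⊞_{sl}(a) ≫ ι⊞_{ε₁} ≫ ι⊞_{ε₂} ≫ ι⊞_{ε₃}` around the cycle `k~ →(id) k~ ↠ k^× ↪ k` the identity.
  That input HOLDS at the degenerate zero-twisted setting and FAILS at the plain diagonal setting
  (`LogFrobeniusLogWallNonVacuity.lean`), so its ORIGIN is a property of print's archimedean arrows, not of the
  interface.  This file locates it, print-shaped:
* `LogFrobeniusSetting.cor55Incompatibility_of_iota_spaceLink_not_surjective` — **for ANY setting**: if `𝒩⊞_{v₀}`
  carries a set-valued functor `Φ` (print: the objects of `𝒩⊞_v` are topological spaces with extra structure,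
  Def 5.4 (iv)–(vi)) under which the `x₀`-component of every `ι⊞`-edge INTO the space-link vertex `k` — at an
  archimedean place this is exactly the natural inclusion `k^× ↪ k` of Def 5.4 (v) — is NOT surjective, then the
  cycle obstruction holds ("writing out explicitly the meaning of such an equality": `Φ` of the identity would factor
  through a non-surjective map), hence `L.Cor55Incompatibility`.
* `LogFrobeniusSetting.archGenuine 𝔄 Vmod isArc` — **the setting with GENUINE archimedean components**: over any
  index set, `𝒳 := 𝒞^hol_TF`-pairs of abc-iut-L4-t2's Aut-holomorphic model (`HolTFPair 𝔄`, Def 4.1), `log` the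
  log-Frobenius functor of that model (the identity in the tree's realisation, `HolTFPair.logFunctor`),
  `𝒩⊞_v = 𝒩_v := 𝒞^hol_TH` (`HolTHPair 𝔄`), and at every ARCHIMEDEAN `v` the printed graph of Def 5.4 (v):
  `λ⊞_{k~} = λ^∼`, `λ⊞_{k^×} = λ^×`, `λ⊞_{k} = λ^∼` (`k~ = (k,+)` in the tree), `ι⊞` along `k~ →(id) k~` the
  identity, along `k~ ↠ k^×` the universal covering `exp_k` (`HolTFPair.iotaTimes`), along `k^× ↪ k` the natural
  inclusion; `ℰ• := EA`, `An•[𝒳] := LinHol` with `κ_LH`, `φ_LH`, `η_LH` (Cor 4.5 (ii) data).  HONEST LABEL: the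
  NONARCHIMEDEAN components of this setting (all `λ^∼`, all `ι⊞` identities) and its MONO-ANALYTIC side are
  PLACEHOLDERS, not print's MLF / mono-analytic data — Cor 5.5 (iv) sentence 1 reads neither; universe bookkeeping:
  the model categories are lifted one universe (`Up`) to fit the interface's large categories.
* `LogFrobeniusSetting.archGenuine_cor55Incompatibility` — at that setting, over every index set with an archimedean
  place and for every `TF`-pair `x₀`, `Cor55Incompatibility` HOLDS, by the first theorem with `Φ :=` the underlying
  arithmetic datum `(𝕏 ↶ M) ↦ M` (`HolTHPair.forget`): the inclusion `k^× ↪ k` misses `0`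
  (`HolTFPair.forget_inclTimes_app_not_surjective`).  So the `⊞`-half of Cor 5.5 (iv), sentence 1, holds wherever
  the archimedean arrows are print's; the settings at which F-0141 fails (`LogFrobeniusLogWallIndependence.lean`)
  are exactly degenerate in that arrow.

Refereed pre-IUT material; OUR kernel check of typed statements and of a labelled model; nothing here bears on
[IUTchIII] Cor. 3.12; no side taken; typed ≠ proved; model-level ≠ node-level.
-/

set_option autoImplicit false

universe w u

open CategoryTheory

namespace Literature.AnabelianGeometry.AbsoluteAnabelian

/-! ## Part 1. The print-shaped sufficient condition (any setting) -/

namespace LogFrobeniusSetting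

variable {Vmod : Type u} {isArc : Vmod → Bool} (L : LogFrobeniusSetting Vmod isArc)

/-- **[AbsTopIII] Cor 5.5 (iv), first sentence, `⊞`-half, from the non-surjectivity of `k^× ↪ k`.**  For any
setting `L`, an archimedean place `v₀`, an object `x₀` of `𝒳` and a set-valued functor `Φ` on `𝒩⊞_{v₀}`: if the
`x₀`-component of `ι⊞_{v₀,ε}` is not surjective under `Φ` for every `ι⊞`-edge `ε` from a pre-log vertex into the
space-link vertex (at an archimedean place: the natural inclusion `k^× ↪ k`, Def 5.4 (v)), then abc-iut-w5-d097's
cycle obstruction holds at `(v₀, x₀)` — a composite ending in a non-surjective map is not the identity, "writing out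
explicitly the meaning of such an equality" (proof of Cor 4.5 (iv) p. 110) — hence `L.Cor55Incompatibility`.
[cite: MochizukiAbsTopIII2015, Cor 5.5 (iv) p. 131] -/
theorem cor55Incompatibility_of_iota_spaceLink_not_surjective (v₀ : Vmod) (hv₀ : isArc v₀ = true) (x₀ : L.X)
    (Φ : L.Nplus v₀ ⥤ Type w)
    (hΦ : ∀ (ν : LogVertex (isArc v₀)), ν.isPostLog = false →
      ∀ ε : LogEdge (isArc v₀) ν (LogVertex.spaceLink (isArc v₀)),
        ¬ Function.Surjective (Φ.map ((L.iota v₀ ε).app x₀) : _ → _)) :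
    L.Cor55Incompatibility := by
  refine L.cor55Incompatibility_of_archObstruction v₀ hv₀ x₀ ?_
  intro ν₂ νₘ _ hₘ ε₁ ε₂ ε₃ a _ m₁ m₂ m₃ _ _ hm₃ hcomp
  -- the domain of `ι⊞_{ε₃}` at `x₀` is `λ⊞_{νₘ}(Λ_{νₘ}(x₀)) = λ⊞_{νₘ}(x₀)`, `νₘ` being pre-log
  have hobj : (L.lam v₀ νₘ).obj x₀ = (frobeniusTwist L.log νₘ.isPostLog ⋙ L.lam v₀ νₘ).obj x₀ := by
    rw [hₘ]
    rfl
  have hm₃' : m₃ = eqToHom hobj ≫ (L.iota v₀ ε₃).app x₀ ≫ eqToHom rfl :=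
    (conj_eqToHom_iff_heq' m₃ ((L.iota v₀ ε₃).app x₀) hobj rfl).mpr hm₃
  -- under `Φ` the composite is the identity function, so its last factor `Φ(m₃)` is surjective
  have hsurj : Function.Surjective (Φ.map m₃ : _ → _) := by
    have h := congrArg Φ.map hcomp
    intro y
    refine ⟨Φ.map m₂ (Φ.map m₁ (Φ.map ((L.lam v₀ (LogVertex.spaceLink (isArc v₀))).map a) y)), ?_⟩
    have hy := CategoryTheory.congr_fun h y
    simp only [Functor.map_comp_apply, Functor.map_id_apply] at hy
    exact hy
  rw [hm₃'] at hsurj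
  simp only [eqToHom_refl, Category.comp_id, Functor.map_comp, types_comp] at hsurj
  exact hΦ νₘ hₘ ε₃ (Function.Surjective.of_comp hsurj)

end LogFrobeniusSetting

/-! ## Part 2. The setting with genuine archimedean components (abc-iut-L4-t2's Aut-holomorphic model) -/

/-! ### Universe bookkeeping: lifting the model categories to large categories -/

/-- The category `C` with its objects lifted one universe: the §5 interface `LogFrobeniusSetting` asks for large
categories (objects in `Type (u+1)`, morphisms in `Type u`), whereas the archimedean model categories
`HolTFPair 𝔄`, `HolTHPair 𝔄`, `EA`, `LinHol 𝔄` have objects and morphisms in the same universe; morphisms are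
unchanged. [folklore] -/
abbrev Up (C : Type (u + 1)) [Category.{u + 1} C] : Type (u + 2) :=
  InducedCategory C (ULift.down : ULift.{u + 2} C → C)

namespace Up

variable {C D : Type (u + 1)} [Category.{u + 1} C] [Category.{u + 1} D]

/-- Lift of a functor along `Up`. [folklore] -/
def liftF (F : C ⥤ D) : Up C ⥤ Up D where
  obj X := ULift.up (F.obj X.down)
  map f := InducedCategory.homMk (F.map f.hom)
  map_id X := InducedCategory.hom_ext (by simp)
  map_comp f g := InducedCategory.hom_ext (by simp)

/-- `liftF` on objects. [folklore] -/
@[simp] private theorem liftF_obj_down (F : C ⥤ D) (X : Up C) : ((liftF F).obj X).down = F.obj X.down := rfl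

/-- `liftF` on morphisms. [folklore] -/
@[simp] private theorem liftF_map_hom (F : C ⥤ D) {X Y : Up C} (f : X ⟶ Y) : ((liftF F).map f).hom = F.map f.hom := rfl

/-- Lift of a natural transformation along `Up`. [folklore] -/
def liftT {F G : C ⥤ D} (α : F ⟶ G) : liftF F ⟶ liftF G where
  app X := InducedCategory.homMk (α.app X.down)
  naturality X Y f := InducedCategory.hom_ext (by simp [α.naturality])

/-- `liftT` on components. [folklore] -/
@[simp] private theorem liftT_app_hom {F G : C ⥤ D} (α : F ⟶ G) (X : Up C) : ((liftT α).app X).hom = α.app X.down := rfl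

/-- Lift of an equivalence along `Up`. [folklore] -/
def liftE (e : C ≌ D) : Up C ≌ Up D where
  functor := liftF e.functor
  inverse := liftF e.inverse
  unitIso := NatIso.ofComponents (fun X => InducedCategory.isoMk (e.unitIso.app X.down))
    (fun f => InducedCategory.hom_ext (e.unit.naturality f.hom))
  counitIso := NatIso.ofComponents (fun X => InducedCategory.isoMk (e.counitIso.app X.down))
    (fun f => InducedCategory.hom_ext (e.counit.naturality f.hom))
  functor_unitIso_comp X := InducedCategory.hom_ext (e.functor_unitIso_comp X.down)

end Up

/-! ### The archimedean arrow `k^× ↪ k` of Def 5.4 (v) in the model, and its non-surjectivity -/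

namespace HolTFPair

variable (𝔄 : AutHolFieldFunctor.{u})

/-- **The natural inclusion `k^× ↪ k` of the archimedean graph `Γ⃗^log_v` (Def 5.4 (v)), as a natural
transformation `λ^× ⟶ λ^∼`** in abc-iut-L4-t2's model (`k~ = (k,+)` there, so the space-link `k` and `k~` are
both `λ^∼`): on arithmetic data the identity of `k` restricted to `k^×`, structure part the identity (the same
formula as `ι_log`, Def 4.1 (iv), whose source is `λ^×(𝔩𝔬𝔤(-))`). [cite: MochizukiAbsTopIII2015, Def 5.4 (v) p. 127] -/
def inclTimes : lamTimes 𝔄 ⟶ lamSim 𝔄 where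
  app P := Hom.restrictTH (𝟙 P) (fun _ _ => Set.mem_univ _)
  naturality P Q φ := by
    apply HolTHPair.Hom.ext
    · change φ.base ≫ 𝟙 Q.X = 𝟙 P.X ≫ φ.base
      rw [Category.comp_id, Category.id_comp]
    · rfl

/-- **`k^× ↪ k` is not surjective**: its underlying map of arithmetic data (`HolTHPair.forget`) misses `0 ∈ k` —
the set-theoretic content of "writing out explicitly the meaning of such an equality" in the proof of
Cor 4.5 (iv) (Lemma 4.4 mechanism), at the level needed by Cor 5.5 (iv).
[cite: MochizukiAbsTopIII2015, Cor 4.5 (iv) p. 110] -/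
theorem forget_inclTimes_app_not_surjective (P : HolTFPair 𝔄) :
    ¬ Function.Surjective ((HolTHPair.forget 𝔄).map ((inclTimes 𝔄).app P) : _ → _) := by
  intro h
  obtain ⟨x, hx⟩ := h ⟨0, Set.mem_univ _⟩
  have hx' := congrArg Subtype.val hx
  rw [HolTHPair.forget_map_apply_coe] at hx'
  exact x.2 hx'

end HolTFPair

/-! ### The setting -/

namespace LogFrobeniusSetting

variable (𝔄 : AutHolFieldFunctor.{u})

/-- `λ⊞_{v,ν}` of the model: at an ARCHIMEDEAN place (Def 5.4 (v): `k~ →(id) k~ ↠ k^× ↪ k`) the post-log `k~`, the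
pre-log `k~` and the space-link `k` go to `λ^∼` (`k~ = (k,+)` in the model) and `k^×` to `λ^×` (Def 4.1 (iv));
at a NONARCHIMEDEAN place of THIS setting every vertex goes to `λ^∼` (PLACEHOLDER — not print's MLF data).
[cite: MochizukiAbsTopIII2015, Def 5.4 (v) p. 127] -/
def archLam : (b : Bool) → LogVertex b → (Up (HolTFPair 𝔄) ⥤ Up (HolTHPair 𝔄))
  | true, ArchVertex.mult => Up.liftF (HolTFPair.lamTimes 𝔄)
  | true, ArchVertex.postLog => Up.liftF (HolTFPair.lamSim 𝔄)
  | true, ArchVertex.pre => Up.liftF (HolTFPair.lamSim 𝔄)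
  | true, ArchVertex.spaceLink => Up.liftF (HolTFPair.lamSim 𝔄)
  | false, _ => Up.liftF (HolTFPair.lamSim 𝔄)

/-- `ι⊞_{v,ε}` of the model before the twist `Λ_ν`: at an ARCHIMEDEAN place, along `k~ →(id) k~` the identity,
along `k~ ↠ k^×` the universal covering `exp_k` (`ι_×`, Def 4.1 (iv)), along `k^× ↪ k` the natural inclusion
(`HolTFPair.inclTimes`); at a NONARCHIMEDEAN place of THIS setting the identity (PLACEHOLDER).
[cite: MochizukiAbsTopIII2015, Def 5.4 (vii) p. 128] -/
noncomputable def archIotaCore : (b : Bool) → {ν₁ ν₂ : LogVertex b} → LogEdge b ν₁ ν₂ → (archLam 𝔄 b ν₁ ⟶ archLam 𝔄 b ν₂)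
  | true, _, _, ArchEdge.postLogId => 𝟙 _
  | true, _, _, ArchEdge.shell => Up.liftT (HolTFPair.iotaTimes 𝔄)
  | true, _, _, ArchEdge.multToSpaceLink => Up.liftT (HolTFPair.inclTimes 𝔄)
  | false, _, _, _ => 𝟙 _

/-- `Λ_ν ∘ λ = λ` for the model's log-Frobenius functor (the identity in abc-iut-L4-t2's realisation,
`HolTFPair.logFunctor`), both values of "is the post-log vertex". [cite: MochizukiAbsTopIII2015, Def 5.4 (vii) p. 128] -/
theorem frobeniusTwist_id_comp (c : Bool) (F : Up (HolTFPair 𝔄) ⥤ Up (HolTHPair 𝔄)) :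
    frobeniusTwist (𝟭 (Up (HolTFPair 𝔄))) c ⋙ F = F := by
  cases c <;> rfl

/-- `ι⊞_{v,ε} : λ⊞_{v,ν₁} ∘ Λ_{ν₁} → λ⊞_{v,ν₂}` of the model (Def 5.4 (vii)): the canonical identification
`Λ_{ν₁} ∘ λ⊞ = λ⊞` followed by `archIotaCore`. [cite: MochizukiAbsTopIII2015, Def 5.4 (vii) p. 128] -/
noncomputable def archIota (b : Bool) {ν₁ ν₂ : LogVertex b} (ε : LogEdge b ν₁ ν₂) :
    frobeniusTwist (𝟭 (Up (HolTFPair 𝔄))) ν₁.isPostLog ⋙ archLam 𝔄 b ν₁ ⟶ archLam 𝔄 b ν₂ :=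
  eqToHom (frobeniusTwist_id_comp 𝔄 _ _) ≫ archIotaCore 𝔄 b ε

/-- The space-link and post-log functors of the model coincide (both `λ^∼`), at every place.
[cite: MochizukiAbsTopIII2015, Cor 5.5 p. 130] -/
theorem archLam_spaceLink_eq_postLog (b : Bool) :
    archLam 𝔄 b (LogVertex.spaceLink b) = archLam 𝔄 b (LogVertex.postLog b) := by
  cases b <;> rfl

/-- `λ⊞_{v,ν}` of the model lies over `EA`: `(𝕏 ↶ M) ↦ 𝕏` after `λ^∼` / `λ^×` is `(𝕏 ↶ k) ↦ 𝕏` on the nose.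
[cite: MochizukiAbsTopIII2015, Def 5.4 (iv) p. 127] -/
def archLamOver : (b : Bool) → (ν : LogVertex b) →
    (archLam 𝔄 b ν ⋙ 𝟭 (Up (HolTHPair 𝔄)) ⋙ Up.liftF (HolTHPair.toEA 𝔄) ≅ Up.liftF (HolTFPair.toEA 𝔄))
  | true, ArchVertex.mult => Iso.refl _
  | true, ArchVertex.postLog => Iso.refl _
  | true, ArchVertex.pre => Iso.refl _
  | true, ArchVertex.spaceLink => Iso.refl _
  | false, _ => Iso.refl _

/-- **The global log-Frobenius setting with GENUINE ARCHIMEDEAN COMPONENTS** (module docstring): `𝒳 := 𝒞^hol_TF`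
(`HolTFPair 𝔄`, lifted), `log` its log-Frobenius functor (the identity in the model), `ℰ• := EA`,
`𝒩⊞_v = 𝒩_v := 𝒞^hol_TH`, `λ⊞`/`ι⊞` at archimedean `v` = the printed graph `k~ →(id) k~ ↠(exp) k^× ↪ k` of
Def 5.4 (v) realised by Def 4.1 (iv)'s `λ^∼`, `λ^×`, `ι_×` and the natural inclusion; `An•[𝒳] := LinHol` with
`κ_LH`, `φ_LH`, `η_LH`.  PLACEHOLDERS (honest label): nonarchimedean components (`λ^∼`, identities), the second
equivalence `An• ≃ ℰ•` (`κ_LH⁻¹`), and the whole mono-analytic side (copies of the holomorphic data with identity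
mono-analyticization) — none of which Cor 5.5 (iv), sentence 1, reads.
[cite: MochizukiAbsTopIII2015, Def 5.4 (v) p. 127] -/
noncomputable def archGenuine (Vmod : Type (u + 1)) (isArc : Vmod → Bool) : LogFrobeniusSetting Vmod isArc where
  X := Up (HolTFPair 𝔄)
  E := Up 𝔄.EA
  proj := Up.liftF (HolTFPair.toEA 𝔄)
  log := 𝟭 _
  logIsoId := Iso.refl _
  logOver := Iso.refl _
  Nplus _ := Up (HolTHPair 𝔄)
  N _ := Up (HolTHPair 𝔄)
  forget _ := 𝟭 _
  toE _ := Up.liftF (HolTHPair.toEA 𝔄)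
  lam v := archLam 𝔄 (isArc v)
  lamOver v := archLamOver 𝔄 (isArc v)
  lam_spaceLink_eq_postLog v := archLam_spaceLink_eq_postLog 𝔄 (isArc v)
  iota v _ _ ε := archIota 𝔄 (isArc v) ε
  An := Up (LinHol 𝔄)
  κAn := Up.liftE (LinHol.linHolEquivalence 𝔄)
  φAn := Up.liftF (LinHol.φLH 𝔄)
  φAn_isEquivalence :=
    haveI := LinHol.φLH_isEquivalence 𝔄
    (Up.liftE (LinHol.φLH 𝔄).asEquivalence).isEquivalence_functor
  ηAn := NatIso.ofComponents (fun X => InducedCategory.isoMk ((LinHol.ηLH 𝔄).app X.down))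
    (fun f => InducedCategory.hom_ext ((LinHol.ηLH 𝔄).hom.naturality f.hom))
  κAn₂ := (Up.liftE (LinHol.linHolEquivalence 𝔄)).symm
  Emono := Up 𝔄.EA
  monoAn := 𝟭 _
  NmonoPlus _ := Up (HolTHPair 𝔄)
  Nmono _ := Up (HolTHPair 𝔄)
  forgetMono _ := 𝟭 _
  toEmono _ := Up.liftF (HolTHPair.toEA 𝔄)
  monoNplus _ := 𝟭 _
  monoN _ := 𝟭 _
  monoHomotopy _ := Iso.refl _
  AnMono := Up (LinHol 𝔄)
  κAnMono := Up.liftE (LinHol.linHolEquivalence 𝔄)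
  ψAnMono _ _ := Up.liftF (LinHol.φLH 𝔄 ⋙ HolTFPair.lamTimes 𝔄)

/-- At an archimedean place, the `ι⊞` of the model along any edge into the space-link vertex — there is exactly
one, `k^× ↪ k` — has a non-surjective underlying map of arithmetic data at every `TF`-pair.  Stated for a Boolean
`b = true` so that it applies to `b := isArc v₀` without transport. [cite: MochizukiAbsTopIII2015, Def 5.4 (v) p. 127] -/
theorem forget_archIota_spaceLink_not_surjective (b : Bool) (hb : b = true) (ν : LogVertex b)
    (ε : LogEdge b ν (LogVertex.spaceLink b)) (x₀ : Up (HolTFPair 𝔄)) :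
    ¬ Function.Surjective
      ((inducedFunctor _ ⋙ HolTHPair.forget 𝔄).map ((archIota 𝔄 b ε).app x₀) : _ → _) := by
  subst hb
  revert ε
  refine fun ε => ?_
  match ν, ε with
  | _, ArchEdge.multToSpaceLink =>
    intro h
    simp only [archIota, NatTrans.comp_app, eqToHom_app] at h
    exact HolTFPair.forget_inclTimes_app_not_surjective 𝔄 x₀.down h

/-- **[AbsTopIII] Cor 5.5 (iv), first sentence, `⊞`-half, HOLDS at the setting with genuine archimedean
components**, over every index set with an archimedean place `v₀` and for every `TF`-pair `x₀`: "`D•_{≤2}` does not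
admit a structure of core on `D•_{≤1}` compatible with the observables `S_log⊞`" (`Cor55Incompatibility`, FACT-LIST
F-0141) — by `cor55Incompatibility_of_iota_spaceLink_not_surjective` with `Φ :=` the underlying arithmetic datum:
`k^× ↪ k` misses `0`.  MODEL-LEVEL (module docstring: the nonarchimedean and mono-analytic parts of this setting are
placeholders). [cite: MochizukiAbsTopIII2015, Cor 5.5 (iv) p. 131] -/
theorem archGenuine_cor55Incompatibility (Vmod : Type (u + 1)) (isArc : Vmod → Bool) (v₀ : Vmod)
    (hv₀ : isArc v₀ = true) (x₀ : Up (HolTFPair 𝔄)) :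
    (archGenuine 𝔄 Vmod isArc).Cor55Incompatibility :=
  (archGenuine 𝔄 Vmod isArc).cor55Incompatibility_of_iota_spaceLink_not_surjective v₀ hv₀ x₀
    (inducedFunctor _ ⋙ HolTHPair.forget 𝔄)
    (fun ν _ ε => forget_archIota_spaceLink_not_surjective 𝔄 (isArc v₀) hv₀ ν ε x₀)

/-- **F-0141 `Cor55Incompatibility` is satisfied by a setting whose archimedean arrows are print's** (contrast the
degenerate zero-twist witness of `LogFrobeniusLogWallNonVacuity.lean` and the failure at the identity-twist diagonal
setting of `LogFrobeniusLogWallIndependence.lean`): existence form over every index set (one universe up) with an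
archimedean place, for every Aut-holomorphic field functor with an elliptically admissible object.
[cite: MochizukiAbsTopIII2015, Cor 5.5 (iv) p. 131] -/
theorem exists_cor55Incompatibility_archGenuine (Vmod : Type (u + 1)) (isArc : Vmod → Bool) (v₀ : Vmod)
    (hv₀ : isArc v₀ = true) (P : HolTFPair 𝔄) :
    ∃ L : LogFrobeniusSetting Vmod isArc, L.X = Up (HolTFPair 𝔄) ∧ L.Cor55Incompatibility :=
  ⟨archGenuine 𝔄 Vmod isArc, rfl, archGenuine_cor55Incompatibility 𝔄 Vmod isArc v₀ hv₀ (ULift.up P)⟩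

/-! ### The `TS`-valued homotopies of the model and the print-faithful log-wall (appended) -/

/-- `TS`-valued `ι_{v,ε}` of the model for ALL edges of `Γ⃗^log_v` (Def 5.4 (vii), "respectively, `Γ⃗^log_v`"),
before the twist: at an ARCHIMEDEAN place every edge already carries `ι⊞` (`archIotaCore`, composed with
`𝒩⊞_v → 𝒩_v`, the identity in the model); at a NONARCHIMEDEAN place of THIS setting the identity (PLACEHOLDER).
[cite: MochizukiAbsTopIII2015, Def 5.4 (vii) p. 128] -/
noncomputable def archIotaTSCore : (b : Bool) → {ν₁ ν₂ : LogVertex b} → LogEdgeTS b ν₁ ν₂ →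
    (archLam 𝔄 b ν₁ ⋙ 𝟭 (Up (HolTHPair 𝔄)) ⟶ archLam 𝔄 b ν₂ ⋙ 𝟭 (Up (HolTHPair 𝔄)))
  | true, _, _, ε => Functor.whiskerRight (archIotaCore 𝔄 true ε) (𝟭 _)
  | false, _, _, _ => 𝟙 _

/-- `TS`-valued `ι_{v,ε} : λ_{v,ν₁} ∘ Λ_{ν₁} → λ_{v,ν₂}` of the model: the canonical identification
`Λ_{ν₁} ∘ λ = λ` followed by `archIotaTSCore`. [cite: MochizukiAbsTopIII2015, Def 5.4 (vii) p. 128] -/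
noncomputable def archIotaTS (b : Bool) {ν₁ ν₂ : LogVertex b} (ε : LogEdgeTS b ν₁ ν₂) :
    (frobeniusTwist (𝟭 (Up (HolTFPair 𝔄))) ν₁.isPostLog ⋙ archLam 𝔄 b ν₁) ⋙ 𝟭 (Up (HolTHPair 𝔄)) ⟶
      archLam 𝔄 b ν₂ ⋙ 𝟭 (Up (HolTHPair 𝔄)) :=
  eqToHom (by rw [frobeniusTwist_id_comp]) ≫ archIotaTSCore 𝔄 b ε

/-- Whiskering a canonical identification is the canonical identification. [folklore] -/
private theorem whiskerRight_eqToHom {C D E : Type*} [Category C] [Category D] [Category E] {G G' : C ⥤ D}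
    (h : G = G') (F : D ⥤ E) : Functor.whiskerRight (eqToHom h) F = eqToHom (by rw [h]) := by
  subst h
  simp [Functor.whiskerRight_id']

/-- On `Γ⃗^⋉_v` the `TS`-valued homotopy of the model is `ι⊞` composed with `𝒩⊞_v → 𝒩_v` (Def 5.4 (vii)), both
kinds of place. [cite: MochizukiAbsTopIII2015, Def 5.4 (vii) p. 128] -/
theorem archIotaTS_toTS (b : Bool) {ν₁ ν₂ : LogVertex b} (ε : LogEdge b ν₁ ν₂) :
    archIotaTS 𝔄 b ε.toTS = Functor.whiskerRight (archIota 𝔄 b ε) (𝟭 (Up (HolTHPair 𝔄))) := by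
  cases b
  · -- nonarchimedean (placeholder identities)
    simp only [archIotaTS, archIota, archIotaTSCore, archIotaCore, archLam, whiskerRight_eqToHom,
      Category.comp_id]
  · -- archimedean: every edge of `Γ⃗^log_arc` carries `ι⊞`
    simp only [archIotaTS, archIota, archIotaTSCore, LogEdge.toTS, Functor.whiskerRight_comp, whiskerRight_eqToHom]

/-- **The `TS`-valued homotopy datum of the setting with genuine archimedean components** (an inhabitant of
abc-iut-L4-t3's `TSHomotopies` interface there): `archIotaTS` at every place, with the printed requirement
`ι|_{Γ⃗^⋉} = ι⊞` (`archIotaTS_toTS`). [cite: MochizukiAbsTopIII2015, Def 5.4 (vii) p. 128] -/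
noncomputable def archGenuineTS (Vmod : Type (u + 1)) (isArc : Vmod → Bool) :
    (archGenuine 𝔄 Vmod isArc).TSHomotopies where
  iota v _ _ ε := archIotaTS 𝔄 (isArc v) ε
  iota_toTS v _ _ ε := archIotaTS_toTS 𝔄 (isArc v) ε

/-- **[AbsTopIII] Cor 5.5 (iv), first sentence, PRINT-FAITHFUL form (`Cor55LogWall`, FACT-LIST F-3082), HOLDS at the
setting with genuine archimedean components**, for EVERY `TS`-valued homotopy datum `T` (in particular the model's own
`archGenuineTS`), over every index set with an archimedean place and every `TF`-pair `x₀`: the print-faithful log-wall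
asks for compatibility with both observables, so it follows from the `S_log⊞`-only form
(`cor55LogWall_of_incompatibility`, abc-iut-L4-t3).  MODEL-LEVEL (module docstring).
[cite: MochizukiAbsTopIII2015, Cor 5.5 (iv) p. 131] -/
theorem archGenuine_cor55LogWall (Vmod : Type (u + 1)) (isArc : Vmod → Bool) (v₀ : Vmod) (hv₀ : isArc v₀ = true)
    (x₀ : Up (HolTFPair 𝔄)) (T : (archGenuine 𝔄 Vmod isArc).TSHomotopies) :
    (archGenuine 𝔄 Vmod isArc).Cor55LogWall T :=
  (archGenuine 𝔄 Vmod isArc).cor55LogWall_of_incompatibility T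
    (archGenuine_cor55Incompatibility 𝔄 Vmod isArc v₀ hv₀ x₀)

/-- Existence form: over every index set (one universe up) with an archimedean place there is a setting WITH a
`TS`-valued homotopy datum at which the print-faithful log-wall holds — contrast its failure at the identity-twist
diagonal setting (`LogFrobeniusLogWallTSIndependence.lean`). [cite: MochizukiAbsTopIII2015, Cor 5.5 (iv) p. 131] -/
theorem exists_cor55LogWall_archGenuine (Vmod : Type (u + 1)) (isArc : Vmod → Bool) (v₀ : Vmod)
    (hv₀ : isArc v₀ = true) (P : HolTFPair 𝔄) :
    ∃ (L : LogFrobeniusSetting Vmod isArc) (T : L.TSHomotopies), L.X = Up (HolTFPair 𝔄) ∧ L.Cor55LogWall T :=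
  ⟨archGenuine 𝔄 Vmod isArc, archGenuineTS 𝔄 Vmod isArc, rfl,
    archGenuine_cor55LogWall 𝔄 Vmod isArc v₀ hv₀ (ULift.up P) (archGenuineTS 𝔄 Vmod isArc)⟩

end LogFrobeniusSetting

end Literature.AnabelianGeometry.AbsoluteAnabelian
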